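import Literature.NumberTheory.EllipticCurves.HeegnerPointsKolyvaginEulerSystem
import Literature.NumberTheory.EllipticCurves.KummerMap
import HarnessLib

/-!
# Crux `ShimuraKolyvaginOrderBoundAtThreeSurj` (item stmt-BirchSwinnertonDyer-19899) — Kolyvagin primes of a DEEPER
# level are Kolyvagin primes of the machine's level (`Frob(ℓ) = Frob(∞)` on `E[n']` ⟹ on `E[n]` for `n ∣ n'`)

Cell `bsd-stepL` (run/shared/lean/pub/bsd-stepL/), seat `bsd-stepL-shim3a` (prover g2), HELPER for the crux
`Summit.BirchSwinnertonDyer.BirchSwinnertonDyer.Theses.ClassRecordThree.ShimuraKolyvaginOrderBoundAtThreeSurj`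
(`--supports stmt-BirchSwinnertonDyer-19899 --as helper`). Road memo HOME/shim/SHIM3A-G2-ROAD-19899.md §2 (γ₃).

## Why

The SHIFT branch of the local half (`ShimuraKolyvaginLocalShift.kolyvaginClass_mem_selmerLocalKer_of_ringClassRational_shift`,
p477215) consumes Euler-system points invariant modulo `p^{M+k}`, which the carrier delivers at Kolyvagin primes of
DEPTH `M + k` (`Frob(ℓ) = Frob(∞)` on `K(E[p^{M+k}])`, McCallum 1991 §3 (3)/§4 at level `M + k`), while x11b3's
machines key every predicate on `IsKolyvaginPrime N W K p ℓ ∧ FrobEqFrobInfty W K (p ^ M) ℓ`. This file records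
the (elementary) half of the glue: a prime of depth `n'` is a prime of every depth `n ∣ n'` — so deep data ARE data
for the machine's predicates, and the only missing piece of the shift road is the Čebotarev SUPPLY of deep primes
(`exists_kolyvaginPrime_gt_pow_kernel` one level deeper; not here).

* `frobEqFrobInfty_of_dvd` — `n ∣ n'` and `Frob(ℓ) = Frob(∞)` on `E[n']` (and on `K`) ⟹ the same on `E[n]`
  (`E[n] ≤ E[n']`).
* `frobEqFrobInfty_pow_of_le` — the reading `M ≤ M'`: depth `p^{M'}` ⟹ depth `p^M`.

THEOREMS ONLY (no `def`, no named fact, no `sorry`; axioms standard). Item 19899 stays OPEN.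

## References

[cite: GrossLMS1991, §3 (3.1)–(3.3)] [cite: McCallumLMS1991, §3 (3), §4 Lemma 4.6]
presearch: not applicable (elementary glue). Tree: `lean search 'frobEqFrobInfty_of_dvd'` → none.
-/

noncomputable section

open scoped Classical
set_option linter.dupNamespace false
namespace Summit.BirchSwinnertonDyer.BirchSwinnertonDyer.Theorems.ShimuraKolyvaginLocalShift

open WeierstrassCurve NumberField IsDedekindDomain Field Literature.NumberTheory.EllipticCurves

/-- **A Kolyvagin prime of depth `n'` is one of depth `n` for `n ∣ n'`**: if a Frobenius at `ℓ` and a complex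
conjugation agree on `E[n'](ℚ̄)` and on `K`, they agree on `E[n](ℚ̄) ≤ E[n'](ℚ̄)` and on `K` (Gross 1991 (3.2)
read at two levels; McCallum 1991 §3 (3)). [cite: GrossLMS1991, §3 (3.2)] [cite: McCallumLMS1991, §3 (3)] -/
theorem frobEqFrobInfty_of_dvd (W : WeierstrassCurve ℚ) (K : Type) [Field K] [NumberField K] {n n' : ℕ}
    (hdvd : n ∣ n') {ℓ : ℕ} (hℓ : FrobEqFrobInfty W K n' ℓ) : FrobEqFrobInfty W K n ℓ := by
  obtain ⟨v, 𝔓, h₁, c₀, hv, h𝔓, hFrob, hc₀, htors, hemb⟩ := hℓ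
  refine ⟨v, 𝔓, h₁, c₀, hv, h𝔓, hFrob, hc₀, fun P ↦ ?_, hemb⟩
  -- `P ∈ E[n] ≤ E[n']`
  have hP' : (P : geomPoints W) ∈ geomTorsion W (n' : ℤ) := by
    obtain ⟨d, rfl⟩ := hdvd
    have hP := (mem_geomTorsion_iff W (n : ℤ) (P : geomPoints W)).mp P.2
    rw [mem_geomTorsion_iff, Nat.cast_mul, mul_comm, mul_zsmul, hP, zsmul_zero]
  have h := congrArg Subtype.val (htors ⟨P, hP'⟩)
  apply Subtype.ext
  simpa only [AddSubgroup.torsionBy.coe_smul] using h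

/-- **Depth `p^{M'}` ⟹ depth `p^M` for `M ≤ M'`** (the form the level-shift road uses: `M' = M + k`).
[cite: McCallumLMS1991, §3 (3), §4 Lemma 4.6] -/
theorem frobEqFrobInfty_pow_of_le (W : WeierstrassCurve ℚ) (K : Type) [Field K] [NumberField K] {p M M' : ℕ}
    (hMM' : M ≤ M') {ℓ : ℕ} (hℓ : FrobEqFrobInfty W K (p ^ M') ℓ) : FrobEqFrobInfty W K (p ^ M) ℓ :=
  frobEqFrobInfty_of_dvd W K (pow_dvd_pow p hMM') hℓ

end Summit.BirchSwinnertonDyer.BirchSwinnertonDyer.Theorems.ShimuraKolyvaginLocalShift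
end
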